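import Literature.Analysis.FluidPDE.LocalTypeIScaling
import HarnessLib

/-!
# Crux `FrequencyRigidity` (stmt-NavierStokesRegularity-2955), line `scaled-energy-split`:
# the Albritton–Barker quantity `𝐈` stays finite under time dilation

Helper file (`--supports stmt-NavierStokesRegularity-2955`; theorems only).  Stub
`stub_typeIBound_timeDilation`: for `β > 0` and real factors `a`, `b`, if
`𝐈 = 𝐈(ℝ³ × ℝ₋; u, p, G) < ∞` (`Literature.Analysis.FluidPDE.typeIBound (Iio 0 ×ˢ univ)`, the supremum
of `A + C + D + E` over all backward parabolic balls of the lower half space), then the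
time-dilated triple `(a u(βt, x), b p(βt, x), a G(βt, x))` again has `𝐈 < ∞`.  This is the
viscosity normalisation `u♭(s, y) = ν⁻¹ u(ν⁻¹ s, y)`, `p♭ = ν⁻² p(ν⁻¹ s, y)` bridging the crux
(any viscosity `ν > 0`) to the unit-viscosity targets.

Proof (covering).  A time-dilated parabolic ball is not a parabolic ball: the dilated fields on
`Q(z, r)`, `z = (t, x)`, are the original fields on `S = (βt - βr², βt) × B(x, r)` (change of
variables `s ↦ βs`, Jacobian `β⁻¹`; none for the essential supremum).  Cover `(βt - βr², βt)` by
the `N ≥ 2β` overlapping intervals `I_k = (βt - k r²/2 - r², βt - k r²/2)`, `k < N`; each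
`I_k × B(x, r)` is the parabolic ball `Q((βt - k r²/2, x), r)` with the same spatial ball (so the
mean-free pressure term keeps its ball average) and top time `≤ 0`, hence contributes at most `𝐈`
to each of `A, C, D, E`.  Summing, every admissible ball of the dilated triple has
`A + C + D + E ≤ (‖a‖² + (‖a‖³ + ‖b‖^{3/2} + a²) β⁻¹) · N · 𝐈`.

## References

* D. Albritton, T. Barker, *On local Type I singularities of the Navier–Stokes equations and
  Liouville theorems*, J. Math. Fluid Mech. 21 (2019), §1 (the quantities `A, C, D, E, 𝐈(ω)`).
  [AlbrittonBarker2019]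
-/

noncomputable section

set_option linter.dupNamespace false

namespace Summit.NavierStokesRegularity.NavierStokesRegularity.Theorems.FrequencyRigidity.ScaledEnergySplit

open Literature.Analysis.FluidPDE MeasureTheory Set Filter Topology Function Metric
open scoped ENNReal NNReal

/-! ## Covering a dilated time interval by parabolic time intervals of length `r²` -/

/-- Arithmetic of the cover: a real `x ∈ (0, N)` lies in `(k, k + 2)` for some natural `k < N`
(take `k = ⌊x - 1/2⌋₊`). [folklore] -/
theorem timeDil_exists_index {x : ℝ} {N : ℕ} (hx0 : 0 < x) (hxN : x < N) :
    ∃ k : ℕ, k < N ∧ (k : ℝ) < x ∧ x < k + 2 := by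
  have hN0 : N ≠ 0 := by
    rintro rfl
    simp only [Nat.cast_zero] at hxN
    linarith
  refine ⟨⌊x - 1 / 2⌋₊, (Nat.floor_lt' hN0).2 (by linarith), ?_, ?_⟩
  · rcases lt_or_ge (x - 1 / 2) 1 with h | h
    · rw [Nat.floor_eq_zero.2 h, Nat.cast_zero]
      exact hx0
    · have := Nat.floor_le (show (0 : ℝ) ≤ x - 1 / 2 by linarith)
      linarith
  · have := Nat.lt_floor_add_one (x - 1 / 2)
    linarith

/-- The dilated time interval `(T - βr², T)` is covered by the `N ≥ 2β` overlapping intervals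
`(T - k r²/2 - r², T - k r²/2)`, `k < N`, of length `r²`. [folklore] -/
theorem timeDil_Ioo_subset_iUnion {β r : ℝ} (T : ℝ) (hr : 0 < r) {N : ℕ} (hN : 2 * β ≤ N) :
    Ioo (T - β * r ^ 2) T ⊆
      ⋃ k : Fin N, Ioo (T - ((k : ℕ) : ℝ) * (r ^ 2 / 2) - r ^ 2) (T - ((k : ℕ) : ℝ) * (r ^ 2 / 2)) := by
  intro t ht
  rw [mem_Ioo] at ht
  have hh : 0 < r ^ 2 / 2 := by positivity
  have hx0 : 0 < (T - t) / (r ^ 2 / 2) := div_pos (by linarith) hh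
  have hxN : (T - t) / (r ^ 2 / 2) < N := by
    rw [div_lt_iff₀ hh]
    nlinarith
  obtain ⟨k, hkN, hk1, hk2⟩ := timeDil_exists_index hx0 hxN
  rw [lt_div_iff₀ hh] at hk1
  rw [div_lt_iff₀ hh] at hk2
  refine mem_iUnion.2 ⟨⟨k, hkN⟩, ?_⟩
  change t ∈ Ioo (T - (k : ℝ) * (r ^ 2 / 2) - r ^ 2) (T - (k : ℝ) * (r ^ 2 / 2))
  rw [mem_Ioo]
  constructor <;> nlinarith

/-- Hence the dilated cylinder `(T - βr², T) × B(x, r)` is covered by the parabolic balls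
`Q((T - k r²/2, x), r)`, `k < N`. [folklore] -/
theorem timeDil_cylinder_subset_iUnion {β r : ℝ} (T : ℝ) (x : EuclideanSpace ℝ (Fin 3))
    (hr : 0 < r) {N : ℕ} (hN : 2 * β ≤ N) :
    Ioo (T - β * r ^ 2) T ×ˢ ball x r ⊆
      ⋃ k : Fin N, parabolicCylinder r
        ((T - ((k : ℕ) : ℝ) * (r ^ 2 / 2), x) : ℝ × EuclideanSpace ℝ (Fin 3)) := by
  rintro ⟨t, y⟩ ⟨ht, hy⟩
  obtain ⟨k, hk⟩ := mem_iUnion.1 (timeDil_Ioo_subset_iUnion T hr hN ht)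
  exact mem_iUnion.2 ⟨k, mk_mem_prod hk hy⟩

/-- A parabolic ball `Q(z, r)`, `r > 0`, fits in the lower half space `ℝ³ × ℝ₋` only if its top
time is `≤ 0`. [folklore] -/
theorem timeDil_fst_nonpos {r : ℝ} {z : ℝ × EuclideanSpace ℝ (Fin 3)} (hr : 0 < r)
    (h : parabolicCylinder r z ⊆ Iio (0 : ℝ) ×ˢ (univ : Set (EuclideanSpace ℝ (Fin 3)))) :
    z.1 ≤ 0 := by
  by_contra hpos
  rw [not_le] at hpos
  have hm0 : 0 < min (r ^ 2) z.1 := lt_min (by positivity) hpos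
  have hmr : min (r ^ 2) z.1 ≤ r ^ 2 := min_le_left _ _
  have hmz : min (r ^ 2) z.1 ≤ z.1 := min_le_right _ _
  have hmem : ((z.1 - min (r ^ 2) z.1 / 2, z.2) : ℝ × EuclideanSpace ℝ (Fin 3)) ∈
      parabolicCylinder r z := by
    rw [mem_parabolicCylinder]
    exact ⟨⟨by linarith, by linarith⟩, by simpa using hr⟩
  have h0 := (h hmem).1
  rw [mem_Iio] at h0
  linarith

/-- Conversely a parabolic ball with top time `≤ 0` lies in the lower half space. [folklore] -/
theorem timeDil_parabolicCylinder_subset {r : ℝ} {w : ℝ × EuclideanSpace ℝ (Fin 3)}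
    (hw : w.1 ≤ 0) :
    parabolicCylinder r w ⊆ Iio (0 : ℝ) ×ˢ (univ : Set (EuclideanSpace ℝ (Fin 3))) := by
  intro q hq
  rw [mem_parabolicCylinder] at hq
  simp only [mem_prod, mem_Iio, mem_univ, and_true]
  linarith [hq.1.2]

/-! ## Change of variables `s ↦ βs` and the covering bounds -/

/-- **Change of variables and covering for space–time integrals**: for `F ≥ 0`, `z = (t, x)`,
`N ≥ 2β`: `∫_{Q(z,r)} F(βs, y) ds dy ≤ β⁻¹ ∑_{k<N} ∫_{Q((βt - k r²/2, x), r)} F`. [folklore] -/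
theorem timeDil_lintegral_le {β r : ℝ} (hβ : 0 < β) (hr : 0 < r) {N : ℕ} (hN : 2 * β ≤ N)
    (z : ℝ × EuclideanSpace ℝ (Fin 3)) (F : ℝ × EuclideanSpace ℝ (Fin 3) → ℝ≥0∞) :
    ∫⁻ q in parabolicCylinder r z, F (β * q.1, q.2) ≤
      ENNReal.ofReal β⁻¹ * ∑ k : Fin N,
        ∫⁻ w in parabolicCylinder r
          ((β * z.1 - ((k : ℕ) : ℝ) * (r ^ 2 / 2), z.2) : ℝ × EuclideanSpace ℝ (Fin 3)), F w := by
  have hpre : stAffine β 1 0 (0 : EuclideanSpace ℝ (Fin 3)) ⁻¹'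
      (Ioo (β * z.1 - β * r ^ 2) (β * z.1) ×ˢ ball z.2 r) = parabolicCylinder r z := by
    rw [stAffine_preimage_cylinder hβ one_pos, parabolicCylinder]
    simp only [sub_zero, inv_one, one_smul, div_one]
    rw [← mul_sub, mul_div_cancel_left₀ _ hβ.ne', mul_div_cancel_left₀ _ hβ.ne']
  have hF : (fun q : ℝ × EuclideanSpace ℝ (Fin 3) => F (β * q.1, q.2)) =
      fun q => F (stAffine β 1 0 (0 : EuclideanSpace ℝ (Fin 3)) q) := by
    funext q
    simp only [stAffine, zero_add, one_smul]
  have h1 : ∫⁻ q in parabolicCylinder r z, F (β * q.1, q.2) =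
      ENNReal.ofReal β⁻¹ * ∫⁻ w in Ioo (β * z.1 - β * r ^ 2) (β * z.1) ×ˢ ball z.2 r, F w := by
    rw [← hpre, hF, setLIntegral_preimage_comp_stAffine hβ one_pos, finrank_euclideanSpace_fin,
      one_pow, mul_one]
  rw [h1]
  refine mul_le_mul_right ?_ _
  calc ∫⁻ w in Ioo (β * z.1 - β * r ^ 2) (β * z.1) ×ˢ ball z.2 r, F w
      ≤ ∫⁻ w in ⋃ k : Fin N, parabolicCylinder r
          ((β * z.1 - ((k : ℕ) : ℝ) * (r ^ 2 / 2), z.2) : ℝ × EuclideanSpace ℝ (Fin 3)), F w :=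
        lintegral_mono_set (timeDil_cylinder_subset_iUnion (β * z.1) z.2 hr hN)
    _ ≤ _ := (lintegral_iUnion_le _ _).trans_eq (tsum_fintype _)

/-- **Covering for essential suprema in time**: `esssup_{s ∈ (t - r², t)} g(βs) ≤
∑_{k<N} esssup_{I_k} g`, `I_k = (βt - k r²/2 - r², βt - k r²/2)`, `N ≥ 2β`. [folklore] -/
theorem timeDil_essSup_le {β r : ℝ} (hβ : 0 < β) (hr : 0 < r) {N : ℕ} (hN : 2 * β ≤ N)
    (z : ℝ × EuclideanSpace ℝ (Fin 3)) (g : ℝ → ℝ≥0∞) :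
    essSup (fun t => g (β * t)) (volume.restrict (Ioo (z.1 - r ^ 2) z.1)) ≤
      ∑ k : Fin N, essSup g (volume.restrict
        (Ioo (β * z.1 - ((k : ℕ) : ℝ) * (r ^ 2 / 2) - r ^ 2) (β * z.1 - ((k : ℕ) : ℝ) * (r ^ 2 / 2)))) := by
  have h1 : (fun t => g (β * t)) = fun s => g (0 + β * s) := by
    funext s
    rw [zero_add]
  have h2 : Ioo (0 + β * (z.1 - r ^ 2)) (0 + β * z.1) = Ioo (β * z.1 - β * r ^ 2) (β * z.1) := by
    rw [zero_add, zero_add, mul_sub]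
  rw [h1, essSup_comp_time_affine hβ 0 (z.1 - r ^ 2) z.1 g, h2]
  refine essSup_le_of_ae_le _ ?_
  refine ae_restrict_of_ae_restrict_of_subset (timeDil_Ioo_subset_iUnion (β * z.1) hr hN) ?_
  refine (ae_restrict_iUnion_iff _ _).2 fun k => ?_
  filter_upwards [ENNReal.ae_le_essSup g] with t ht
  exact ht.trans (Finset.single_le_sum (f := fun k : Fin N => essSup g (volume.restrict
    (Ioo (β * z.1 - ((k : ℕ) : ℝ) * (r ^ 2 / 2) - r ^ 2) (β * z.1 - ((k : ℕ) : ℝ) * (r ^ 2 / 2)))))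
    (fun _ _ => zero_le) (Finset.mem_univ k))

/-! ## The four quantities of the dilated triple -/

/-- **`A` under time dilation**: `A(a u(β·, ·); Q(z, r)) ≤ ‖a‖² ∑_{k<N} A(u; Q((βt - k r²/2, x), r))`.
[folklore] -/
theorem timeDil_cknAEss_le {β r : ℝ} (hβ : 0 < β) (hr : 0 < r) {N : ℕ} (hN : 2 * β ≤ N) (a : ℝ)
    (z : ℝ × EuclideanSpace ℝ (Fin 3))
    (u : ℝ → EuclideanSpace ℝ (Fin 3) → EuclideanSpace ℝ (Fin 3)) :
    cknAEss r z (fun t x => a • u (β * t) x) ≤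
      ‖a‖ₑ ^ 2 * ∑ k : Fin N,
        cknAEss r ((β * z.1 - ((k : ℕ) : ℝ) * (r ^ 2 / 2), z.2) : ℝ × EuclideanSpace ℝ (Fin 3)) u := by
  have hg : (fun t : ℝ => (ENNReal.ofReal r)⁻¹ * ∫⁻ x in ball z.2 r, ‖a • u (β * t) x‖ₑ ^ 2) =
      fun t => ‖a‖ₑ ^ 2 *
        (fun τ : ℝ => (ENNReal.ofReal r)⁻¹ * ∫⁻ x in ball z.2 r, ‖u τ x‖ₑ ^ 2) (β * t) := by
    funext t
    simp only [enorm_smul, mul_pow]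
    rw [lintegral_const_mul' _ _ (ENNReal.pow_ne_top enorm_ne_top), mul_left_comm]
  show essSup (fun t : ℝ => (ENNReal.ofReal r)⁻¹ * ∫⁻ x in ball z.2 r, ‖a • u (β * t) x‖ₑ ^ 2)
      (volume.restrict (Ioo (z.1 - r ^ 2) z.1)) ≤
    ‖a‖ₑ ^ 2 * ∑ k : Fin N,
      essSup (fun τ : ℝ => (ENNReal.ofReal r)⁻¹ * ∫⁻ x in ball z.2 r, ‖u τ x‖ₑ ^ 2)
        (volume.restrict (Ioo (β * z.1 - ((k : ℕ) : ℝ) * (r ^ 2 / 2) - r ^ 2)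
          (β * z.1 - ((k : ℕ) : ℝ) * (r ^ 2 / 2))))
  rw [hg, ENNReal.essSup_const_mul]
  exact mul_le_mul_right (timeDil_essSup_le hβ hr hN z
    (fun τ : ℝ => (ENNReal.ofReal r)⁻¹ * ∫⁻ x in ball z.2 r, ‖u τ x‖ₑ ^ 2)) _

/-- **`C` under time dilation**: `C(a u(β·, ·); Q(z, r)) ≤ ‖a‖³ β⁻¹ ∑_{k<N} C(u; Q((βt - k r²/2, x), r))`.
[folklore] -/
theorem timeDil_cknC_le {β r : ℝ} (hβ : 0 < β) (hr : 0 < r) {N : ℕ} (hN : 2 * β ≤ N) (a : ℝ)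
    (z : ℝ × EuclideanSpace ℝ (Fin 3))
    (u : ℝ → EuclideanSpace ℝ (Fin 3) → EuclideanSpace ℝ (Fin 3)) :
    cknC r z (fun t x => a • u (β * t) x) ≤
      ‖a‖ₑ ^ 3 * ENNReal.ofReal β⁻¹ * ∑ k : Fin N,
        cknC r ((β * z.1 - ((k : ℕ) : ℝ) * (r ^ 2 / 2), z.2) : ℝ × EuclideanSpace ℝ (Fin 3)) u := by
  have hF : (fun q : ℝ × EuclideanSpace ℝ (Fin 3) => ‖a • u (β * q.1) q.2‖ₑ ^ (3 : ℕ)) =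
      fun q => ‖a‖ₑ ^ 3 *
        (fun w : ℝ × EuclideanSpace ℝ (Fin 3) => ‖u w.1 w.2‖ₑ ^ (3 : ℕ)) (β * q.1, q.2) := by
    funext q
    simp only [enorm_smul, mul_pow]
  show (ENNReal.ofReal r ^ 2)⁻¹ *
      ∫⁻ q in parabolicCylinder r z, ‖a • u (β * q.1) q.2‖ₑ ^ (3 : ℕ) ≤
    ‖a‖ₑ ^ 3 * ENNReal.ofReal β⁻¹ * ∑ k : Fin N, (ENNReal.ofReal r ^ 2)⁻¹ *
      ∫⁻ q in parabolicCylinder r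
        ((β * z.1 - ((k : ℕ) : ℝ) * (r ^ 2 / 2), z.2) : ℝ × EuclideanSpace ℝ (Fin 3)),
          ‖u q.1 q.2‖ₑ ^ (3 : ℕ)
  rw [hF, lintegral_const_mul' _ _ (ENNReal.pow_ne_top enorm_ne_top)]
  refine (mul_le_mul_right (mul_le_mul_right (timeDil_lintegral_le hβ hr hN z
    (fun w : ℝ × EuclideanSpace ℝ (Fin 3) => ‖u w.1 w.2‖ₑ ^ (3 : ℕ))) _) _).trans_eq ?_
  rw [← Finset.mul_sum]
  ring

/-- **`D` under time dilation** (same spatial ball, so the same ball averages):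
`D(b p(β·, ·); Q(z, r)) ≤ ‖b‖^{3/2} β⁻¹ ∑_{k<N} D(p; Q((βt - k r²/2, x), r))`. [folklore] -/
theorem timeDil_cknDOsc_le {β r : ℝ} (hβ : 0 < β) (hr : 0 < r) {N : ℕ} (hN : 2 * β ≤ N) (b : ℝ)
    (z : ℝ × EuclideanSpace ℝ (Fin 3)) (p : ℝ → EuclideanSpace ℝ (Fin 3) → ℝ) :
    cknDOsc r z (fun t x => b * p (β * t) x) ≤
      ‖b‖ₑ ^ (3 / 2 : ℝ) * ENNReal.ofReal β⁻¹ * ∑ k : Fin N,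
        cknDOsc r ((β * z.1 - ((k : ℕ) : ℝ) * (r ^ 2 / 2), z.2) : ℝ × EuclideanSpace ℝ (Fin 3)) p := by
  have hmean : ∀ s : ℝ, ⨍ y in ball z.2 r, b * p s y = b * ⨍ y in ball z.2 r, p s y := fun s => by
    rw [average_eq', average_eq', integral_const_mul]
  have hF : (fun w : ℝ × EuclideanSpace ℝ (Fin 3) =>
      ‖b * p (β * w.1) w.2 - ⨍ y in ball z.2 r, b * p (β * w.1) y‖ₑ ^ (3 / 2 : ℝ)) =
      fun w => ‖b‖ₑ ^ (3 / 2 : ℝ) *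
        (fun w' : ℝ × EuclideanSpace ℝ (Fin 3) =>
          ‖p w'.1 w'.2 - ⨍ y in ball z.2 r, p w'.1 y‖ₑ ^ (3 / 2 : ℝ)) (β * w.1, w.2) := by
    funext w
    rw [hmean (β * w.1), ← mul_sub, enorm_mul, ENNReal.mul_rpow_of_nonneg _ _ (by norm_num)]
  show (ENNReal.ofReal r ^ 2)⁻¹ * ∫⁻ w in parabolicCylinder r z,
      ‖b * p (β * w.1) w.2 - ⨍ y in ball z.2 r, b * p (β * w.1) y‖ₑ ^ (3 / 2 : ℝ) ≤
    ‖b‖ₑ ^ (3 / 2 : ℝ) * ENNReal.ofReal β⁻¹ * ∑ k : Fin N, (ENNReal.ofReal r ^ 2)⁻¹ *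
      ∫⁻ w in parabolicCylinder r
        ((β * z.1 - ((k : ℕ) : ℝ) * (r ^ 2 / 2), z.2) : ℝ × EuclideanSpace ℝ (Fin 3)),
          ‖p w.1 w.2 - ⨍ y in ball z.2 r, p w.1 y‖ₑ ^ (3 / 2 : ℝ)
  rw [hF, lintegral_const_mul' _ _ (ENNReal.rpow_ne_top_of_nonneg (by norm_num) enorm_ne_top)]
  refine (mul_le_mul_right (mul_le_mul_right (timeDil_lintegral_le hβ hr hN z
    (fun w' : ℝ × EuclideanSpace ℝ (Fin 3) =>
      ‖p w'.1 w'.2 - ⨍ y in ball z.2 r, p w'.1 y‖ₑ ^ (3 / 2 : ℝ))) _) _).trans_eq ?_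
  rw [← Finset.mul_sum]
  ring

/-- **`E` under time dilation**: `E(a G(β·, ·); Q(z, r)) ≤ a² β⁻¹ ∑_{k<N} E(G; Q((βt - k r²/2, x), r))`.
[folklore] -/
theorem timeDil_cknE_le {β r : ℝ} (hβ : 0 < β) (hr : 0 < r) {N : ℕ} (hN : 2 * β ≤ N) (a : ℝ)
    (z : ℝ × EuclideanSpace ℝ (Fin 3))
    (G : ℝ → EuclideanSpace ℝ (Fin 3) → EuclideanSpace ℝ (Fin 3) →L[ℝ] EuclideanSpace ℝ (Fin 3)) :
    cknE r z (fun t x => a • G (β * t) x) ≤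
      ENNReal.ofReal (a ^ 2) * ENNReal.ofReal β⁻¹ * ∑ k : Fin N,
        cknE r ((β * z.1 - ((k : ℕ) : ℝ) * (r ^ 2 / 2), z.2) : ℝ × EuclideanSpace ℝ (Fin 3)) G := by
  have hF : (fun q : ℝ × EuclideanSpace ℝ (Fin 3) =>
      ENNReal.ofReal (frobeniusNormSq (a • G (β * q.1) q.2))) =
      fun q => ENNReal.ofReal (a ^ 2) *
        (fun w : ℝ × EuclideanSpace ℝ (Fin 3) =>
          ENNReal.ofReal (frobeniusNormSq (G w.1 w.2))) (β * q.1, q.2) := by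
    funext q
    rw [frobeniusNormSq_smul, ENNReal.ofReal_mul (sq_nonneg a)]
  show (ENNReal.ofReal r)⁻¹ *
      ∫⁻ q in parabolicCylinder r z, ENNReal.ofReal (frobeniusNormSq (a • G (β * q.1) q.2)) ≤
    ENNReal.ofReal (a ^ 2) * ENNReal.ofReal β⁻¹ * ∑ k : Fin N, (ENNReal.ofReal r)⁻¹ *
      ∫⁻ q in parabolicCylinder r
        ((β * z.1 - ((k : ℕ) : ℝ) * (r ^ 2 / 2), z.2) : ℝ × EuclideanSpace ℝ (Fin 3)),
          ENNReal.ofReal (frobeniusNormSq (G q.1 q.2))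
  rw [hF, lintegral_const_mul' _ _ ENNReal.ofReal_ne_top]
  refine (mul_le_mul_right (mul_le_mul_right (timeDil_lintegral_le hβ hr hN z
    (fun w : ℝ × EuclideanSpace ℝ (Fin 3) =>
      ENNReal.ofReal (frobeniusNormSq (G w.1 w.2)))) _) _).trans_eq ?_
  rw [← Finset.mul_sum]
  ring

/-! ## The stub -/

/-- **`𝐈` stays finite under time dilation** (stub `stub_typeIBound_timeDilation` of line
`scaled-energy-split`): for `β > 0` and real `a`, `b`, if `𝐈(ℝ³ × ℝ₋; u, p, G) < ∞` then
`𝐈(ℝ³ × ℝ₋; a u(β·, ·), b p(β·, ·), a G(β·, ·)) < ∞`; quantitatively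
`𝐈♭ ≤ (‖a‖² + (‖a‖³ + ‖b‖^{3/2} + a²) β⁻¹) N 𝐈` for any natural `N ≥ 2β`, by covering each
time-dilated parabolic ball by `N` parabolic balls with the same spatial ball.
[cite: AlbrittonBarker2019, §1] -/
theorem stub_typeIBound_timeDilation : ∀ (β a b : ℝ) (u : ℝ → EuclideanSpace ℝ (Fin 3) → EuclideanSpace ℝ (Fin 3)) (p : ℝ → EuclideanSpace ℝ (Fin 3) → ℝ) (G : ℝ → EuclideanSpace ℝ (Fin 3) → EuclideanSpace ℝ (Fin 3) →L[ℝ] EuclideanSpace ℝ (Fin 3)), 0 < β → Literature.Analysis.FluidPDE.typeIBound (Set.Iio (0:ℝ) ×ˢ Set.univ) u p G < ⊤ → Literature.Analysis.FluidPDE.typeIBound (Set.Iio (0:ℝ) ×ˢ Set.univ) (fun t x => a • u (β * t) x) (fun t x => b * p (β * t) x) (fun t x => a • G (β * t) x) < ⊤ := by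
  intro β a b u p G hβ hI
  obtain ⟨N, hN⟩ := exists_nat_ge (2 * β)
  -- the constant is finite
  have hβ' : ENNReal.ofReal β⁻¹ < ⊤ := ENNReal.ofReal_lt_top
  have ha2 : ‖a‖ₑ ^ 2 < ⊤ := ENNReal.pow_lt_top enorm_lt_top
  have ha3 : ‖a‖ₑ ^ 3 < ⊤ := ENNReal.pow_lt_top enorm_lt_top
  have hb : ‖b‖ₑ ^ (3 / 2 : ℝ) < ⊤ := ENNReal.rpow_lt_top_of_nonneg (by norm_num) enorm_ne_top
  have hK : (‖a‖ₑ ^ 2 + ‖a‖ₑ ^ 3 * ENNReal.ofReal β⁻¹ + ‖b‖ₑ ^ (3 / 2 : ℝ) * ENNReal.ofReal β⁻¹ +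
      ENNReal.ofReal (a ^ 2) * ENNReal.ofReal β⁻¹) *
      ((N : ℝ≥0∞) * typeIBound (Iio (0 : ℝ) ×ˢ (univ : Set (EuclideanSpace ℝ (Fin 3)))) u p G) < ⊤ :=
    ENNReal.mul_lt_top
      (ENNReal.add_lt_top.2 ⟨ENNReal.add_lt_top.2 ⟨ENNReal.add_lt_top.2
        ⟨ha2, ENNReal.mul_lt_top ha3 hβ'⟩, ENNReal.mul_lt_top hb hβ'⟩,
        ENNReal.mul_lt_top ENNReal.ofReal_lt_top hβ'⟩)
      (ENNReal.mul_lt_top (ENNReal.natCast_lt_top N) hI)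
  refine lt_of_le_of_lt (typeIBound_le_iff.2 fun r hr z hz => ?_) hK
  -- every admissible ball of the dilated triple is bounded by the constant
  set I₀ := typeIBound (Iio (0 : ℝ) ×ˢ (univ : Set (EuclideanSpace ℝ (Fin 3)))) u p G with hI₀
  have hz1 : z.1 ≤ 0 := timeDil_fst_nonpos hr hz
  have hIk : ∀ k : Fin N,
      abScaledSum r ((β * z.1 - ((k : ℕ) : ℝ) * (r ^ 2 / 2), z.2) : ℝ × EuclideanSpace ℝ (Fin 3))
        u p G ≤ I₀ := fun k => by
    refine abScaledSum_le_typeIBound hr (timeDil_parabolicCylinder_subset ?_)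
    have h1 : β * z.1 ≤ 0 := by nlinarith
    have h2 : 0 ≤ ((k : ℕ) : ℝ) * (r ^ 2 / 2) := by positivity
    show β * z.1 - ((k : ℕ) : ℝ) * (r ^ 2 / 2) ≤ 0
    linarith
  have hXle : ∀ w : ℝ × EuclideanSpace ℝ (Fin 3),
      cknAEss r w u ≤ abScaledSum r w u p G ∧ cknC r w u ≤ abScaledSum r w u p G ∧
        cknDOsc r w p ≤ abScaledSum r w u p G ∧ cknE r w G ≤ abScaledSum r w u p G := fun w =>
    ⟨le_add_right (le_add_right le_self_add), le_add_right (le_add_right le_add_self),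
      le_add_right le_add_self, le_add_self⟩
  have hsumI : ∑ _k : Fin N, I₀ = N * I₀ := by
    rw [Finset.sum_const, Finset.card_univ, Fintype.card_fin, nsmul_eq_mul]
  have hA : ∑ k : Fin N,
      cknAEss r ((β * z.1 - ((k : ℕ) : ℝ) * (r ^ 2 / 2), z.2) : ℝ × EuclideanSpace ℝ (Fin 3)) u ≤
        N * I₀ :=
    (Finset.sum_le_sum fun k _ => ((hXle _).1.trans (hIk k))).trans_eq hsumI
  have hC : ∑ k : Fin N,
      cknC r ((β * z.1 - ((k : ℕ) : ℝ) * (r ^ 2 / 2), z.2) : ℝ × EuclideanSpace ℝ (Fin 3)) u ≤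
        N * I₀ :=
    (Finset.sum_le_sum fun k _ => ((hXle _).2.1.trans (hIk k))).trans_eq hsumI
  have hD : ∑ k : Fin N,
      cknDOsc r ((β * z.1 - ((k : ℕ) : ℝ) * (r ^ 2 / 2), z.2) : ℝ × EuclideanSpace ℝ (Fin 3)) p ≤
        N * I₀ :=
    (Finset.sum_le_sum fun k _ => ((hXle _).2.2.1.trans (hIk k))).trans_eq hsumI
  have hE : ∑ k : Fin N,
      cknE r ((β * z.1 - ((k : ℕ) : ℝ) * (r ^ 2 / 2), z.2) : ℝ × EuclideanSpace ℝ (Fin 3)) G ≤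
        N * I₀ :=
    (Finset.sum_le_sum fun k _ => ((hXle _).2.2.2.trans (hIk k))).trans_eq hsumI
  calc abScaledSum r z (fun t x => a • u (β * t) x) (fun t x => b * p (β * t) x)
        (fun t x => a • G (β * t) x)
      = cknAEss r z (fun t x => a • u (β * t) x) + cknC r z (fun t x => a • u (β * t) x) +
          cknDOsc r z (fun t x => b * p (β * t) x) + cknE r z (fun t x => a • G (β * t) x) := rfl
    _ ≤ ‖a‖ₑ ^ 2 * (N * I₀) + ‖a‖ₑ ^ 3 * ENNReal.ofReal β⁻¹ * (N * I₀) +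
          ‖b‖ₑ ^ (3 / 2 : ℝ) * ENNReal.ofReal β⁻¹ * (N * I₀) +
          ENNReal.ofReal (a ^ 2) * ENNReal.ofReal β⁻¹ * (N * I₀) :=
        add_le_add (add_le_add (add_le_add
          ((timeDil_cknAEss_le hβ hr hN a z u).trans (mul_le_mul_right hA _))
          ((timeDil_cknC_le hβ hr hN a z u).trans (mul_le_mul_right hC _)))
          ((timeDil_cknDOsc_le hβ hr hN b z p).trans (mul_le_mul_right hD _)))
          ((timeDil_cknE_le hβ hr hN a z G).trans (mul_le_mul_right hE _))
    _ = _ := by ring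

end Summit.NavierStokesRegularity.NavierStokesRegularity.Theorems.FrequencyRigidity.ScaledEnergySplit
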